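import Literature.AnabelianGeometry.SemiGraphs.ApproximatorImageProofs
import Mathlib.GroupTheory.Index
import HarnessLib

/-!
# Anabelioids: the image of `Π_{e'}` along a 2-commutative square of pull-back functors

Mochizuki, *Semi-graphs of anabelioids*, Publ. RIMS **42** (2006), §2: a morphism `𝒢' → 𝒢` of
semi-graphs of anabelioids carries, for a branch `b'` of `e'` over `b` of `e` abutting to `v'` over
`v`, a 2-cell `φ_b` between the composites `𝒢'_{e'} → 𝒢'_{v'} → 𝒢_v` and `𝒢'_{e'} → 𝒢_e → 𝒢_v`
(Remark 2.4.2 p. 26); Remark 2.2.1 p. 24: along a finite étale covering `Π_{v'}`, `Π_{e'}` are the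
stabilisers in `Π_v`, `Π_e`; Remark 2.4.1 p. 26 (aloof / estranged descend to coverings)
[cite: MochizukiSemiAnbd2006, Rem. 2.4.2 p.26].

PROOF-ONLY bookkeeping (abc-iut L3 row `L3:FiniteEtaleLocalDictionary`, part (d), L6-t17), at the
level of abstract functors `Q : V ⥤ V'` (vertex pull-back), `R : E ⥤ E'` (edge pull-back),
`P : V ⥤ E`, `P' : V' ⥤ E'` (the `b_*`, `b'_*` pull-backs) and a 2-cell `γ : Q ⋙ P' ≅ P ⋙ R`:

* `map_map_range_pi1Map_eq_of_sq` — the image of `Π_{b'} = Im(Π_{e'} → Π_{v'})` under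
  `Π_{v'} → Π_v` (basepoint `Q ⋙ P' ⋙ F`), moved along the `γ`-induced isomorphism
  `Aut (Q ⋙ P' ⋙ F) ≃* Aut (P ⋙ R ⋙ F)` (`Aut.autMulEquivOfIso`, the shape `SemiGraphs` uses),
  EQUALS the image under `Π_e → Π_v` of `Im(Π_{e'} → Π_e)`;
* `map_map_range_pi1Map_le_of_sq` — hence it lies in the branch subgroup `Π_b = Im(Π_e → Π_v)` at
  the basepoint `R ⋙ F` of `𝒢_e`;
* `relIndex_map_map_range_pi1Map_ne_zero_of_sq` — and has FINITE index in it as soon as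
  `Im(Π_{e'} → Π_e)` has finite index in `Π_e` (which the local dictionary supplies for a finite
  étale `R`: index `= deg`).

These are the inputs of [SemiAnbd] Rem. 2.4.1 (aloof/estranged) together with
`CoverticialCoveringGroupLemmas.lean`.
-/

namespace Literature.AnabelianGeometry.Anabelioids

open CategoryTheory CategoryTheory.Functor

universe w v u₁ u₂ u₃ u₄

variable {V : Type u₁} [Category.{v} V] {V' : Type u₂} [Category.{v} V']
  {E : Type u₃} [Category.{v} E] {E' : Type u₄} [Category.{v} E']

/-- **Image of `Π_{b'}` in `Π_v` along a 2-commutative square.** For `γ : Q ⋙ P' ≅ P ⋙ R` and a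
basepoint `F` of `E'`: the image under `π₁(Q)` (at the basepoint `P' ⋙ F`) of the range of `π₁(P')`,
moved along the `γ`-induced isomorphism of fundamental groups `Aut (Q ⋙ P' ⋙ F) ≃* Aut (P ⋙ R ⋙ F)`,
EQUALS the image under `π₁(P)` (at `R ⋙ F`) of the range of `π₁(R)` — both are the range of `π₁`
of the composite, and isomorphic composites give conjugate homomorphisms.
[cite: MochizukiSemiAnbd2006, Rem. 2.4.2 p.26] -/
theorem map_map_range_pi1Map_eq_of_sq (Q : V ⥤ V') (R : E ⥤ E') (P : V ⥤ E) (P' : V' ⥤ E')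
    (γ : Q ⋙ P' ≅ P ⋙ R) (F : E' ⥤ FintypeCat.{w}) :
    ((pi1Map P' F).range.map (pi1Map Q (P' ⋙ F))).map
        (Aut.autMulEquivOfIso (isoWhiskerRight γ F) :
          Aut (Q ⋙ P' ⋙ F) ≃* Aut (P ⋙ R ⋙ F)).toMonoidHom =
      (pi1Map R F).range.map (pi1Map P (R ⋙ F)) := by
  have key : ∀ σ : Aut F,
      (Aut.autMulEquivOfIso (isoWhiskerRight γ F) : Aut (Q ⋙ P' ⋙ F) ≃* Aut (P ⋙ R ⋙ F))
        (pi1Map Q (P' ⋙ F) (pi1Map P' F σ)) = pi1Map P (R ⋙ F) (pi1Map R F σ) := by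
    intro σ
    refine Iso.ext (NatTrans.ext (funext fun A => ?_))
    show F.map (γ.inv.app A) ≫ σ.hom.app (P'.obj (Q.obj A)) ≫ F.map (γ.hom.app A) =
      σ.hom.app (R.obj (P.obj A))
    have nat' : σ.hom.app (P'.obj (Q.obj A)) ≫ F.map (γ.hom.app A) =
        F.map (γ.hom.app A) ≫ σ.hom.app (R.obj (P.obj A)) := (σ.hom.naturality (γ.hom.app A)).symm
    exact (congrArg (fun k => F.map (γ.inv.app A) ≫ k) nat').trans
      ((F.mapIso (γ.app A)).inv_hom_id_assoc _)
  ext τ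
  simp only [Subgroup.mem_map, MonoidHom.mem_range, exists_exists_eq_and]
  constructor
  · rintro ⟨σ, rfl⟩
    exact ⟨σ, (key σ).symm⟩
  · rintro ⟨σ, rfl⟩
    exact ⟨σ, key σ⟩

/-- Hence the image of `Π_{b'}` in `Π_v`, moved along `γ`, lies in the branch subgroup
`Π_b = Im(π₁(P))` at the basepoint `R ⋙ F` of `E`. [cite: MochizukiSemiAnbd2006, Rem. 2.4.1 p.26] -/
theorem map_map_range_pi1Map_le_of_sq (Q : V ⥤ V') (R : E ⥤ E') (P : V ⥤ E) (P' : V' ⥤ E')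
    (γ : Q ⋙ P' ≅ P ⋙ R) (F : E' ⥤ FintypeCat.{w}) :
    ((pi1Map P' F).range.map (pi1Map Q (P' ⋙ F))).map
        (Aut.autMulEquivOfIso (isoWhiskerRight γ F) :
          Aut (Q ⋙ P' ⋙ F) ≃* Aut (P ⋙ R ⋙ F)).toMonoidHom ≤
      (pi1Map P (R ⋙ F)).range := by
  rw [map_map_range_pi1Map_eq_of_sq Q R P P' γ F]
  exact Subgroup.map_le_range _ _

/-- **Finite index.** If `Im(π₁(R)) = Π_{e'}` has finite index in `Π_e = Aut (R ⋙ F)` (for a finite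
étale `R`: index `= deg`, `FiniteEtaleLocalDictionary`), then the image of `Π_{b'}` in `Π_v`, moved
along `γ`, has FINITE index in the branch subgroup `Π_b`. [cite: MochizukiSemiAnbd2006, Rem. 2.4.1 p.26] -/
theorem relIndex_map_map_range_pi1Map_ne_zero_of_sq (Q : V ⥤ V') (R : E ⥤ E') (P : V ⥤ E)
    (P' : V' ⥤ E') (γ : Q ⋙ P' ≅ P ⋙ R) (F : E' ⥤ FintypeCat.{w})
    (hfin : (pi1Map R F).range.index ≠ 0) :
    (((pi1Map P' F).range.map (pi1Map Q (P' ⋙ F))).map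
        (Aut.autMulEquivOfIso (isoWhiskerRight γ F) :
          Aut (Q ⋙ P' ⋙ F) ≃* Aut (P ⋙ R ⋙ F)).toMonoidHom).relIndex
      (pi1Map P (R ⋙ F)).range ≠ 0 := by
  rw [map_map_range_pi1Map_eq_of_sq Q R P P' γ F, MonoidHom.range_eq_map (pi1Map P (R ⋙ F)),
    Subgroup.relIndex_map_map, top_sup_eq, Subgroup.relIndex_top_right]
  intro h0
  exact hfin (Nat.eq_zero_of_zero_dvd (h0 ▸ Subgroup.index_dvd_of_le le_sup_left))

end Literature.AnabelianGeometry.Anabelioids
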